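import Literature.MathematicalPhysics.QuantumFieldTheory.Balaban1983to89.B6Geom246MultiLevelBox

/-!
# `Balaban1983to89.B6Cover236MultiLevelBlocks` — [B6] THE CUBE COVER `𝒟` AND THE PARTITION OF UNITY (2.36)
`Σ_□ h_□² = 1` ON THE BLOCK LATTICE `𝔅` OF A GENUINE NESTED FAMILY OF DOMAINS ON A BOX, WITH THE COVER CONSTANTS OF
PROP. 2.3: finite overlap `n₀`, the two-level window of a cube, the Lipschitz constant `s/M` of `h_□` IN THE DISTANCE
(2.46), and the gap `m_g·M` between `supp h_□` and the complement of the enlarged cube (file 4 of the multi-level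
`(Q′G′²Q′*)⁻¹` programme; no existing module is touched; no fact is minted)

FRAMING (verbatim cell line):
statement-level skeleton of published theorems with citation tags; proofs where landed; nothing here is a claim about the Yang–Mills mass gap

Source under audit (cell pub-balaban / lit-balaban): T. Bałaban, *Propagators and renormalization transformations for
lattice gauge theories. II*, Commun. Math. Phys. **96** (1984) 223–250 [`Balaban1984PropagatorsII`, "B6"], p. 229 [PDF 7]
(before (2.36)), p. 235 [PDF 13] ((2.70) and «We assume that either □̃ ⊂ B^j(Λ_j), or it intersects B^{j+1}(Λ_{j+1})
also»), p. 237 [PDF 15] ((2.82)–(2.85): the uses of the cover constants) — materialised text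
`paper:balaban1984-cmp96-propagators-rt-ii` p0007/p0013/p0015 re-read this generation.  Unit `lit-balaban-p21` (Phase-2
proof seat p21 gen 13), HOME `run/shared/lean/pub/lit-balaban/`, B6 fold owner r03, referee ref-4.

## WHAT IS PRINTED (p. 229, p. 235, verbatim up to notation)

p. 229: «Each set Λ_j is a sum of big blocks of the size ML^jη … We cover B^j(Λ_j) by a sum of cubes □ of the size
2ML^jη, each cube being a sum of 2^d big blocks with a center y ∈ Λ_j (more exactly it belongs to the boundary of this
set also). Taking these covers for all j from 0 to k we get a family 𝒟 of cubes □ of different sizes and such that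
T_η = ⋃_{□∈𝒟} □. … We construct also the corresponding family of functions h described in (1.118), and rescale them to
proper scales. They satisfy Σ_{□∈𝒟} h_□² = 1. (2.36)»  p. 235: «The approximate inverse can be constructed by taking
inverses of the localized operators (Q′G′²Q′*)↾□ and glueing them together by the decomposition of unity {h_□}. …
C = Σ_{□∈𝒟} h_□C_□h_□. (2.70) … We assume that either □̃ ⊂ B^j(Λ_j), or it intersects B^{j+1}(Λ_{j+1}) also.»  The
constants of the cover enter (2.84)–(2.85) p. 237: the commutator `[h_□, ·]` costs `O(1)·M^{−1}` («|h_□(y) − h_□(y″)| ≤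
O(1)(ML^jη)^{−1}|y − y″|»-type Lipschitz bound, our `s/M` in the distance `d`), the off-diagonal terms use «y ∉ □̃′»
(our gap `m_g·M ≤ d(y, supp h_{□′})`), and the sums over □ use the finite overlap of the cubes (our `n₀`).

## WHAT THIS FILE CERTIFIES (kernel-checked; setting of `B6MultiLevelBoxOperator` / `B6Geom246MultiLevelBox`)

For a nested family `D : Domains d ℓ M_h k P R` (levels `1 … k` on the fine box, `M = L·M_h`, `R ≥ 2L`) and its block
lattice `𝔅 = bset D` with the distance (2.46) `d = (geom D).dist`:
* §1 the profile `ψ` (= 1 on `|t| ≤ ½`, = 0 on `|t| ≥ 1`, 2-Lipschitz) and the `ℓ¹`-Lipschitz bound for products of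
  `[0, 1]`-valued factors;
* §2 **THE COVER `𝒟`** (`cubes D`): the ACTIVE BIG BLOCKS `(j, β)` — big `j`-blocks (side `S = ML^j` fine sites,
  `side`, centre `ctr`) containing a site of `B^j(Λ_j)` (`wit`) —, each standing for the concentric cube □ of side `2S`
  carrying the bump `θ_□(p) = Π_μ ψ((p_μ − ctr_μ)/S)` (`theta`; = 1 on the big block, = 0 off □, `2(d+1)/S`-Lipschitz in
  the sup metric: `theta_eq_one`, `dist_lt_of_theta_ne_zero`, `abs_theta_sub_le`);
* §3 **(2.36)**: `h_□(y) = θ_□(cen y)/(Σ_{□′} θ_{□′}(cen y)²)^{1/2}` on `𝔅` (`hcov`; the normalising sum is `≥ 1` because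
  the own big block of `y` is active and its bump is 1 at `cen y`: `own`, `one_le_nsq`), **`Σ_□ h_□(y)² = 1`**
  (`sum_hcov_sq`); the enlarged cube `□⁺ = {y : |cen y − ctr|_∞ ≤ 5S/4}` (`Q`, indicator `cubeInd ∈ {0, 1}`) with
  `□⁺·h_□ = h_□` (`cubeInd_mul_hcov`);
* §4 **THE TWO-LEVEL WINDOW** («either □̃ ⊂ B^j(Λ_j), or it intersects B^{j+1}(Λ_{j+1}) also»): every block of `□⁺` has
  level `j − 1`, `j` or `j + 1` (`window`, from (2.2) via `Domains.lev_window` at the site of the block nearest to the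
  witness, `proj`), never both `j − 1` and `j + 1` (`Domains.not_both_sides`), so with the cube scale `js □ = j − 1` if
  `□⁺` meets level `j − 1` and `j` otherwise, **every block of `□⁺` has level `js □` or `js □ + 1`** (`hcube`);
* §5 **FINITE OVERLAP**: at most `n₀ = 3·2^{d+1}` of the `h_□` are non-zero at a block (`card_filter_hcov_ne_zero_le`:
  three candidate levels, two candidate labels per coordinate);
* §6 **THE WALK LEMMA**: an admissible chain of `n` bonds from a block of level `≤ m` either has sup-displacement
  `≤ n·L^m` or reaches a site of level `≥ m + 1` within `n·L^m` (`walk_disp_or_exit`, the induction of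
  `B6Geom246MultiLevelBox.walk_disp`); with (2.2) at level `j + 1` («y ∉ □̃′» is far from `B^{j+2}`): for `y″ ∈ □⁺`,
  `|cen y″ − cen y|_∞ ≤ d(y″, y)·L^{j+1}` unless `d(y″, y)·L^{j+1} > (RL − 7/4)S` (`disp_or_far`), hence
  **THE GAP** `cubeInd_□(y) = 0`, `h_□(y″) ≠ 0 ⟹ d(y, y″) > M_h/4 = M/(4L)` (`gap_of_cubeInd_eq_zero`);
* §7 **THE LIPSCHITZ BOUND IN `d`**: `|h_□(y) − h_□(y″)| ≤ (s/M)·d(y, y″)` with `s = sLip d L = 8L + 2(d+1)L³(1 + 6·2^{d+1})`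
  (`abs_hcov_sub_le`: far pairs by `0 ≤ h ≤ 1`, near pairs by the Lipschitz bounds of the ≤ `2n₀` bumps active at the
  two centres, whose levels are `≥ j − 2`);
* §8 the package `cover236_multiLevelBlocks` — the seven cover hypotheses `hover`, `hpf01`, `hph`, `h236`, `hLip`,
  `hcube`, `hgap` of `B6Prop23TwoLevel.prop23_assembled_twoLevel` for `g = ` the box geometry with `M = L·M_h`,
  uniformly in `k`, `M_h ≥ 1`, `P`, `D`.

## HONEST SCOPE

The cubes are indexed by the active big blocks (print: by centres «y ∈ Λ_j (… boundary … also)» of `2M`-cubes; the two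
families differ by a relabelling and by the shape of the (1.118) profile, which print does not fix beyond (2.36) and the
`O(1)(ML^j η)^{−1}` gradient bound); the normalisation `θ/(Σθ²)^{1/2}` across ADJACENT LEVELS is ours (print does not say
how the level-`j` and level-`(j+1)` families are matched on `∂B^{j+1}(Λ_{j+1})`, cell divergence D-b06.38/42); a cube of
level `j` may see the level `j − 1` (print: «either □̃ ⊂ B^j(Λ_j), or it intersects B^{j+1}(Λ_{j+1}) also» — our `js □`
records the finer of the two levels actually met); the constants `n₀ = 3·2^{d+1}`, `m_g = 1/(4L)`, `s = O(d2^dL³)` are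
`L`-dependent and `k`-, `M`-independent, which is all (2.85) («O(M^{−1})», «for M large enough») uses.  `R ≥ 2L`,
`M_h ≥ 1`, `L ≥ 2`.  Nothing is inferred from the manuscript: every step is kernel-checked.
-/

namespace Literature.MathematicalPhysics.QuantumFieldTheory.Balaban1983to89.B6Cover236MultiLevelBlocks

open Finset
open Literature.MathematicalPhysics.QuantumFieldTheory.Balaban1983to89.B4ContourShift (supNorm)
open Literature.MathematicalPhysics.QuantumFieldTheory.Balaban1983to89.B4Reflection242 (boxDom mem_boxDom blk)
open Literature.MathematicalPhysics.QuantumFieldTheory.Balaban1983to89.B6MultiLevelBoxOperator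
open Literature.MathematicalPhysics.QuantumFieldTheory.Balaban1983to89.B6Geom246MultiLevelBox

noncomputable section

variable {d : ℕ}

/-! ## §1 The profile and the product bound -/

section Profile

/-- the one-dimensional profile `ψ(t) = max{0, min{1, 2 − 2|t|}}`: `= 1` on `|t| ≤ ½`, `= 0` on `|t| ≥ 1`, 2-Lipschitz
(a rescaled (1.118)-type cut-off; print fixes only (2.36) and the gradient bound). [cite: Balaban1984PropagatorsII, p.229 before (2.36); Balaban1984PropagatorsI, (1.118) p.36] -/
def psi (t : ℝ) : ℝ := max (min (2 - 2 * |t|) 1) 0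

/-- `ψ ≥ 0`. [folklore] -/
private theorem psi_nonneg (t : ℝ) : 0 ≤ psi t := le_max_right _ _

/-- `ψ ≤ 1`. [folklore] -/
private theorem psi_le_one (t : ℝ) : psi t ≤ 1 := max_le (min_le_right _ _) zero_le_one

/-- `ψ = 1` on `|t| ≤ ½`. [folklore] -/
private theorem psi_eq_one {t : ℝ} (h : |t| ≤ 1 / 2) : psi t = 1 := by
  unfold psi
  rw [min_eq_right (by linarith), max_eq_left (zero_le_one' ℝ)]

/-- `ψ = 0` on `|t| ≥ 1`. [folklore] -/
private theorem psi_eq_zero {t : ℝ} (h : 1 ≤ |t|) : psi t = 0 := by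
  unfold psi
  exact max_eq_right (min_le_of_left_le (by linarith))

/-- `ψ` is 2-Lipschitz. [folklore] -/
private theorem abs_psi_sub_le (t t' : ℝ) : |psi t - psi t'| ≤ 2 * |t - t'| := by
  unfold psi
  calc |max (min (2 - 2 * |t|) 1) 0 - max (min (2 - 2 * |t'|) 1) 0|
      ≤ |min (2 - 2 * |t|) 1 - min (2 - 2 * |t'|) 1| := abs_max_sub_max_le_abs _ _ _
    _ ≤ max |(2 - 2 * |t|) - (2 - 2 * |t'|)| |(1 : ℝ) - 1| := abs_min_sub_min_le_max _ _ _ _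
    _ = |(2 - 2 * |t|) - (2 - 2 * |t'|)| := by
        rw [sub_self, abs_zero]; exact max_eq_left (abs_nonneg _)
    _ = 2 * |(|t'| - |t|)| := by
        rw [show (2 - 2 * |t|) - (2 - 2 * |t'|) = 2 * (|t'| - |t|) by ring, abs_mul, abs_two]
    _ ≤ 2 * |t - t'| := by
        rw [abs_sub_comm t t']
        exact mul_le_mul_of_nonneg_left (abs_abs_sub_abs_le_abs_sub _ _) zero_le_two

/-- products of `[0, 1]`-valued factors: `|Π a − Π b| ≤ Σ |a − b|` (adapted from
`Literature.Analysis.FunctionSpaces.TorusHardCoreCutoff.abs_prod_sub_prod_le_sum`, reproved to keep the imports local).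
[folklore] -/
private theorem abs_prod_sub_prod_le_sum {ι : Type*} (s : Finset ι) {a b : ι → ℝ}
    (ha0 : ∀ i ∈ s, 0 ≤ a i) (ha1 : ∀ i ∈ s, a i ≤ 1) (hb0 : ∀ i ∈ s, 0 ≤ b i) (hb1 : ∀ i ∈ s, b i ≤ 1) :
    |∏ i ∈ s, a i - ∏ i ∈ s, b i| ≤ ∑ i ∈ s, |a i - b i| := by
  classical
  induction s using Finset.induction_on with
  | empty => simp
  | insert j s hj ih =>
    rw [Finset.prod_insert hj, Finset.prod_insert hj, Finset.sum_insert hj]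
    have hA : |∏ i ∈ s, a i - ∏ i ∈ s, b i| ≤ ∑ i ∈ s, |a i - b i| :=
      ih (fun i hi => ha0 i (mem_insert_of_mem hi)) (fun i hi => ha1 i (mem_insert_of_mem hi))
        (fun i hi => hb0 i (mem_insert_of_mem hi)) (fun i hi => hb1 i (mem_insert_of_mem hi))
    have haj0 := ha0 j (mem_insert_self j s)
    have haj1 := ha1 j (mem_insert_self j s)
    have hB0 : 0 ≤ ∏ i ∈ s, b i := prod_nonneg fun i hi => hb0 i (mem_insert_of_mem hi)
    have hB1 : ∏ i ∈ s, b i ≤ 1 :=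
      prod_le_one (fun i hi => hb0 i (mem_insert_of_mem hi)) fun i hi => hb1 i (mem_insert_of_mem hi)
    have hD0 := abs_nonneg (∏ i ∈ s, a i - ∏ i ∈ s, b i)
    have hd0 := abs_nonneg (a j - b j)
    calc |a j * ∏ i ∈ s, a i - b j * ∏ i ∈ s, b i|
        = |a j * (∏ i ∈ s, a i - ∏ i ∈ s, b i) + (a j - b j) * ∏ i ∈ s, b i| := by congr 1; ring
      _ ≤ |a j * (∏ i ∈ s, a i - ∏ i ∈ s, b i)| + |(a j - b j) * ∏ i ∈ s, b i| := abs_add_le _ _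
      _ = a j * |∏ i ∈ s, a i - ∏ i ∈ s, b i| + |a j - b j| * ∏ i ∈ s, b i := by
          rw [abs_mul, abs_mul, abs_of_nonneg haj0, abs_of_nonneg hB0]
      _ ≤ 1 * |∏ i ∈ s, a i - ∏ i ∈ s, b i| + |a j - b j| * 1 := by nlinarith
      _ ≤ |a j - b j| + ∑ i ∈ s, |a i - b i| := by linarith

/-- the clamp into `[lo, hi] ∋ c` moves a point no farther from it than `c` is. [folklore] -/
private theorem abs_clamp_sub_le {lo hi c t : ℝ} (hlo : lo ≤ c) (hhi : c ≤ hi) : |max lo (min t hi) - t| ≤ |c - t| := by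
  rcases le_total t hi with h1 | h1
  · rw [min_eq_left h1]
    rcases le_total lo t with h2 | h2
    · rw [max_eq_right h2, sub_self, abs_zero]; exact abs_nonneg _
    · rw [max_eq_left h2, abs_of_nonneg (by linarith), abs_of_nonneg (by linarith)]; linarith
  · rw [min_eq_right h1, max_eq_right (hlo.trans hhi), abs_of_nonpos (by linarith), abs_of_nonpos (by linarith)]
    linarith

/-- quotients `θ/a`, `θ′ ∈ [0, 1]`, `a, b ≥ 1`: `|θ/a − θ′/b| ≤ |θ − θ′| + |a − b|`. [folklore] -/
private theorem abs_div_sub_div_le {θ θ' a b : ℝ} (hθ' : 0 ≤ θ') (hθ'1 : θ' ≤ 1)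
    (ha : 1 ≤ a) (hb : 1 ≤ b) : |θ / a - θ' / b| ≤ |θ - θ'| + |a - b| := by
  have ha0 : 0 < a := by linarith
  have hb0 : 0 < b := by linarith
  have e : θ / a - θ' / b = (θ - θ') / a + θ' * (b - a) / (a * b) := by
    field_simp; ring
  rw [e]
  refine (abs_add_le _ _).trans (add_le_add ?_ ?_)
  · rw [abs_div, abs_of_pos ha0]
    exact div_le_self (abs_nonneg _) ha
  · rw [abs_div, abs_mul, abs_of_nonneg hθ', abs_of_pos (mul_pos ha0 hb0), abs_sub_comm b a]
    have hab : 1 ≤ a * b := by nlinarith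
    calc θ' * |a - b| / (a * b) ≤ θ' * |a - b| := div_le_self (by positivity) hab
      _ ≤ 1 * |a - b| := mul_le_mul_of_nonneg_right hθ'1 (abs_nonneg _)
      _ = |a - b| := one_mul _

/-- square roots of sums of squares of `[0, 1]`-valued families agreeing off `N`, both sums `≥ 1`:
`|(Σu²)^{1/2} − (Σv²)^{1/2}| ≤ Σ_{N} |u − v|`. [folklore] -/
private theorem abs_sqrt_sub_sqrt_le {ι : Type*} [Fintype ι] [DecidableEq ι] (N : Finset ι) {u v : ι → ℝ}
    (hu0 : ∀ i, 0 ≤ u i) (hu1 : ∀ i, u i ≤ 1) (hv0 : ∀ i, 0 ≤ v i) (hv1 : ∀ i, v i ≤ 1)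
    (hN : ∀ i, i ∉ N → u i = v i) (hF : 1 ≤ ∑ i, u i ^ 2) (hF' : 1 ≤ ∑ i, v i ^ 2) :
    |Real.sqrt (∑ i, u i ^ 2) - Real.sqrt (∑ i, v i ^ 2)| ≤ ∑ i ∈ N, |u i - v i| := by
  set A := Real.sqrt (∑ i, u i ^ 2) with hA
  set B := Real.sqrt (∑ i, v i ^ 2) with hB
  have hA1 : 1 ≤ A := by rw [hA, ← Real.sqrt_one]; exact Real.sqrt_le_sqrt hF
  have hB1 : 1 ≤ B := by rw [hB, ← Real.sqrt_one]; exact Real.sqrt_le_sqrt hF'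
  have hAsq : A ^ 2 = ∑ i, u i ^ 2 := Real.sq_sqrt (by linarith)
  have hBsq : B ^ 2 = ∑ i, v i ^ 2 := Real.sq_sqrt (by linarith)
  -- `Σ u² − Σ v²` lives on `N`
  have hdiff : ∑ i, u i ^ 2 - ∑ i, v i ^ 2 = ∑ i ∈ N, (u i ^ 2 - v i ^ 2) := by
    rw [← Finset.sum_sub_distrib, ← Finset.sum_add_sum_compl N (fun i => u i ^ 2 - v i ^ 2)]
    have h0 : ∑ i ∈ Nᶜ, (u i ^ 2 - v i ^ 2) = 0 :=
      Finset.sum_eq_zero fun i hi => by rw [hN i (Finset.mem_compl.1 hi), sub_self]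
    rw [h0, add_zero]
  have hbd : |∑ i, u i ^ 2 - ∑ i, v i ^ 2| ≤ 2 * ∑ i ∈ N, |u i - v i| := by
    rw [hdiff, Finset.mul_sum]
    refine (Finset.abs_sum_le_sum_abs _ _).trans (Finset.sum_le_sum fun i _ => ?_)
    rw [show u i ^ 2 - v i ^ 2 = (u i - v i) * (u i + v i) by ring, abs_mul,
      abs_of_nonneg (by linarith [hu0 i, hv0 i] : 0 ≤ u i + v i)]
    have := abs_nonneg (u i - v i)
    nlinarith [hu1 i, hv1 i]
  -- `|A − B|(A + B) = |A² − B²|`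
  have hkey : |A - B| * (A + B) = |∑ i, u i ^ 2 - ∑ i, v i ^ 2| := by
    rw [← hAsq, ← hBsq, ← abs_of_pos (by linarith : 0 < A + B), ← abs_mul]
    congr 1; ring
  have h2 : |A - B| * 2 ≤ |A - B| * (A + B) := mul_le_mul_of_nonneg_left (by linarith) (abs_nonneg _)
  nlinarith

end Profile

/-! ## §2 The cover `𝒟`: active big blocks, sides, centres, bumps -/

section Cubes

variable {ℓ Mh k R : ℕ} {P : Fin (d + 1) → ℕ} (D : Domains d ℓ Mh k P R)

/-- **THE COVER `𝒟`**: the active big blocks `(j, β)` — level `j`, big-block label `β` (side `ML^j` fine sites) of a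
site of `B^j(Λ_j)`; each stands for the concentric cube □ of side `2ML^j` («cubes □ of the size 2ML^jη, each cube being
a sum of 2^d big blocks with a center y ∈ Λ_j»). [cite: Balaban1984PropagatorsII, p.229 before (2.36)] -/
def cubes : Finset (ℕ × (Fin (d + 1) → ℤ)) :=
  (boxDom (N0 ℓ Mh k P)).image fun x => (D.lev x, blk (bigSide ℓ Mh (D.lev x)) x)

/-- an active big block has a witness: a box site of its level inside it. [cite: Balaban1984PropagatorsII, p.229 («with a center y ∈ Λ_j»)] -/
theorem exists_wit (i : ↥(cubes D)) :
    ∃ x ∈ boxDom (N0 ℓ Mh k P), D.lev x = i.1.1 ∧ blk (bigSide ℓ Mh i.1.1) x = i.1.2 := by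
  obtain ⟨x, hx, he⟩ := Finset.mem_image.1 i.2
  have h1 : D.lev x = i.1.1 := congrArg Prod.fst he
  refine ⟨x, hx, h1, ?_⟩
  have h2 : blk (bigSide ℓ Mh (D.lev x)) x = i.1.2 := congrArg Prod.snd he
  rwa [h1] at h2

/-- the witness site of an active big block. [cite: Balaban1984PropagatorsII, p.229, dictionary] -/
def wit (i : ↥(cubes D)) : ↥(boxDom (N0 ℓ Mh k P)) :=
  ⟨(exists_wit D i).choose, (exists_wit D i).choose_spec.1⟩

/-- the witness has the level of the cube. [cite: Balaban1984PropagatorsII, p.229, dictionary] -/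
theorem lev_wit (i : ↥(cubes D)) : D.lev (wit D i).1 = i.1.1 := (exists_wit D i).choose_spec.2.1

/-- the witness lies in the big block. [cite: Balaban1984PropagatorsII, p.229, dictionary] -/
theorem blk_wit (i : ↥(cubes D)) : blk (bigSide ℓ Mh i.1.1) (wit D i).1 = i.1.2 := (exists_wit D i).choose_spec.2.2

/-- the side `S = ML^j = M_h L^{j+1}` of the big block, in fine sites. [cite: Balaban1984PropagatorsII, p.229 («big blocks of the size ML^jη»)] -/
def side (i : ↥(cubes D)) : ℝ := (bigSide ℓ Mh i.1.1 : ℝ)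

/-- `S = L^{j+1}·M_h`. [cite: Balaban1984PropagatorsII, p.229, dictionary] -/
theorem side_eq (i : ↥(cubes D)) : side D i = (((ℓ + 1) ^ (i.1.1 + 1) : ℕ) : ℝ) * Mh := by
  unfold side bigSide; push_cast; ring

/-- `S > 0` (`M_h ≥ 1`). [cite: Balaban1984PropagatorsII, p.229, dictionary] -/
theorem side_pos (hMh : 1 ≤ Mh) (i : ↥(cubes D)) : 0 < side D i := by
  unfold side; exact Nat.cast_pos.2 (one_le_bigSide hMh _)

/-- the centre of the big block (sup-metric coordinates of `ℝ^{d+1}`). [cite: Balaban1984PropagatorsII, p.229 («with a center y»), dictionary] -/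
def ctr (i : ↥(cubes D)) : Fin (d + 1) → ℝ := fun μ => ((i.1.2 μ : ℝ) + 1 / 2) * side D i

variable {D}

/-- block labels: `b·blk_b(x)_μ ≤ x_μ < b·blk_b(x)_μ + b`. [folklore] -/
private theorem blk_bounds {b : ℕ} (hb : 1 ≤ b) (x : Fin (d + 1) → ℤ) (μ : Fin (d + 1)) :
    (b : ℤ) * blk b x μ ≤ x μ ∧ x μ < (b : ℤ) * blk b x μ + b := by
  have hn : (0 : ℤ) < b := by exact_mod_cast hb
  have h1 : (b : ℤ) * (x μ / b) + x μ % b = x μ := Int.mul_ediv_add_emod _ _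
  have h2 := Int.emod_nonneg (x μ) hn.ne'
  have h3 := Int.emod_lt_of_pos (x μ) hn
  show (b : ℤ) * (x μ / b) ≤ x μ ∧ x μ < (b : ℤ) * (x μ / b) + b
  constructor <;> linarith

variable (D)

/-- a site of the big block is within `S/2` of its centre. [cite: Balaban1984PropagatorsII, p.229, dictionary] -/
theorem dist_toR_ctr_le (hMh : 1 ≤ Mh) {i : ↥(cubes D)} {x : Fin (d + 1) → ℤ}
    (hx : blk (bigSide ℓ Mh i.1.1) x = i.1.2) : dist (toR x) (ctr D i) ≤ side D i / 2 := by
  have hS := side_pos D hMh i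
  refine (dist_pi_le_iff (by linarith)).2 fun μ => ?_
  rw [Real.dist_eq]
  obtain ⟨h1, h2⟩ := blk_bounds (one_le_bigSide hMh i.1.1) x μ
  rw [hx] at h1 h2
  have h2' : x μ ≤ (bigSide ℓ Mh i.1.1 : ℤ) * i.1.2 μ + bigSide ℓ Mh i.1.1 - 1 := by omega
  have h1r : (bigSide ℓ Mh i.1.1 : ℝ) * (i.1.2 μ : ℝ) ≤ (x μ : ℝ) := by exact_mod_cast h1
  have h2r : (x μ : ℝ) ≤ (bigSide ℓ Mh i.1.1 : ℝ) * (i.1.2 μ : ℝ) + (bigSide ℓ Mh i.1.1 : ℝ) - 1 := by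
    exact_mod_cast h2'
  show |(x μ : ℝ) - ((i.1.2 μ : ℝ) + 1 / 2) * (bigSide ℓ Mh i.1.1 : ℝ)| ≤ (bigSide ℓ Mh i.1.1 : ℝ) / 2
  rw [abs_le]; constructor <;> linarith

/-- **THE BUMP `θ_□`** of the cube of an active big block at a point of `ℝ^{d+1}`: `Π_μ ψ((p_μ − ctr_μ)/S)`.
[cite: Balaban1984PropagatorsII, p.229 («the corresponding family of functions h described in (1.118)»)] -/
def theta (i : ↥(cubes D)) (p : Fin (d + 1) → ℝ) : ℝ := ∏ μ, psi ((p μ - ctr D i μ) / side D i)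

/-- `θ ≥ 0`. [cite: Balaban1984PropagatorsII, p.229 before (2.36), bookkeeping] -/
theorem theta_nonneg (i : ↥(cubes D)) (p : Fin (d + 1) → ℝ) : 0 ≤ theta D i p :=
  Finset.prod_nonneg fun _ _ => psi_nonneg _

/-- `θ ≤ 1`. [cite: Balaban1984PropagatorsII, p.229 before (2.36), bookkeeping] -/
theorem theta_le_one (i : ↥(cubes D)) (p : Fin (d + 1) → ℝ) : theta D i p ≤ 1 :=
  Finset.prod_le_one (fun _ _ => psi_nonneg _) fun _ _ => psi_le_one _

/-- `θ_□ = 1` on the big block (points within `S/2` of the centre). [cite: Balaban1984PropagatorsII, p.229, bookkeeping] -/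
theorem theta_eq_one (hMh : 1 ≤ Mh) {i : ↥(cubes D)} {p : Fin (d + 1) → ℝ} (h : dist p (ctr D i) ≤ side D i / 2) :
    theta D i p = 1 := by
  have hS := side_pos D hMh i
  refine Finset.prod_eq_one fun μ _ => psi_eq_one ?_
  rw [abs_div, abs_of_pos hS, div_le_iff₀ hS]
  have := dist_le_pi_dist p (ctr D i) μ
  rw [Real.dist_eq] at this
  linarith

/-- `θ_□ ≠ 0` only within `S` of the centre (the cube □ of side `2S`). [cite: Balaban1984PropagatorsII, p.229 («cubes □ of the size 2ML^jη»), bookkeeping] -/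
theorem dist_lt_of_theta_ne_zero (hMh : 1 ≤ Mh) {i : ↥(cubes D)} {p : Fin (d + 1) → ℝ} (h : theta D i p ≠ 0) :
    dist p (ctr D i) < side D i := by
  have hS := side_pos D hMh i
  by_contra hge
  have hex : ¬ ∀ μ, dist (p μ) (ctr D i μ) < side D i := fun hall => hge ((dist_pi_lt_iff hS).2 hall)
  push Not at hex
  obtain ⟨μ, hμ⟩ := hex
  apply h
  refine Finset.prod_eq_zero (Finset.mem_univ μ) (psi_eq_zero ?_)
  rw [abs_div, abs_of_pos hS, le_div_iff₀ hS, one_mul]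
  rwa [Real.dist_eq] at hμ

/-- **THE BUMP IS `2(d+1)/S`-LIPSCHITZ** in the sup metric («|∇h_□| ≤ O(1)(ML^jη)^{−1}»).
[cite: Balaban1984PropagatorsII, p.237 (2.84) (the gradient of h_□), bookkeeping] -/
theorem abs_theta_sub_le (hMh : 1 ≤ Mh) (i : ↥(cubes D)) (p p' : Fin (d + 1) → ℝ) :
    |theta D i p - theta D i p'| ≤ 2 * ((d : ℝ) + 1) / side D i * dist p p' := by
  have hS := side_pos D hMh i
  unfold theta
  calc |∏ μ, psi ((p μ - ctr D i μ) / side D i) - ∏ μ, psi ((p' μ - ctr D i μ) / side D i)|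
      ≤ ∑ μ, |psi ((p μ - ctr D i μ) / side D i) - psi ((p' μ - ctr D i μ) / side D i)| :=
        abs_prod_sub_prod_le_sum _ (fun _ _ => psi_nonneg _) (fun _ _ => psi_le_one _)
          (fun _ _ => psi_nonneg _) fun _ _ => psi_le_one _
    _ ≤ ∑ _μ : Fin (d + 1), 2 * (dist p p' / side D i) := by
        refine Finset.sum_le_sum fun μ _ => (abs_psi_sub_le _ _).trans ?_
        rw [← sub_div, abs_div, abs_of_pos hS, show p μ - ctr D i μ - (p' μ - ctr D i μ) = p μ - p' μ by ring]
        have := dist_le_pi_dist p p' μ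
        rw [Real.dist_eq] at this
        exact mul_le_mul_of_nonneg_left (div_le_div_of_nonneg_right this hS.le) zero_le_two
    _ = 2 * ((d : ℝ) + 1) / side D i * dist p p' := by
        rw [Finset.sum_const, Finset.card_univ, Fintype.card_fin, nsmul_eq_mul]; push_cast; ring

/-! ### the own big block of a block of `𝔅` -/

/-- the big block of the level of `y ∈ 𝔅` containing `y` is active (witness: the corner of `y`). [cite: Balaban1984PropagatorsII, p.229 («Each set Λ_j is a sum of big blocks»)] -/
def own (y : ↥(bset D)) : ↥(cubes D) :=
  ⟨(y.1.1, blk (bigSide ℓ Mh y.1.1) (corner D y)), by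
    unfold cubes
    refine Finset.mem_image.2 ⟨corner D y, corner_mem D y, ?_⟩
    rw [lev_corner]⟩

/-- the centre of a block is within `S/2` of the centre of its own big block (the block grid refines the big-block grid).
[cite: Balaban1984PropagatorsII, (2.1) p.224 («Ω_j^{(j)} … is a sum of big blocks»), bookkeeping] -/
theorem dist_cen_ctr_own_le (hMh : 1 ≤ Mh) (y : ↥(bset D)) :
    dist (cen D y) (ctr D (own D y)) ≤ side D (own D y) / 2 := by
  have hS := side_pos D hMh (own D y)
  refine (dist_pi_le_iff (by linarith)).2 fun μ => ?_
  rw [Real.dist_eq, abs_le]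
  set n : ℕ := (ℓ + 1) ^ y.1.1 with hn
  have hn1 : 1 ≤ n := Nat.one_le_pow _ _ (by omega)
  have hSn : bigSide ℓ Mh y.1.1 = n * (Mh * (ℓ + 1)) := by rw [bigSide_eq]
  set β : ℤ := blk (bigSide ℓ Mh y.1.1) (corner D y) μ with hβ
  obtain ⟨h1, h2⟩ := blk_bounds (one_le_bigSide hMh y.1.1) (corner D y) μ
  rw [← hβ] at h1 h2
  have hc : corner D y μ = (n : ℤ) * y.1.2 μ := rfl
  rw [hc] at h1 h2
  -- `nλ + n ≤ Sβ + S`: both sides are multiples of `n`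
  have h3 : (n : ℤ) * y.1.2 μ + n ≤ (bigSide ℓ Mh y.1.1 : ℤ) * β + bigSide ℓ Mh y.1.1 := by
    have eS : (bigSide ℓ Mh y.1.1 : ℤ) * β + bigSide ℓ Mh y.1.1 = (n : ℤ) * ((Mh : ℤ) * (ℓ + 1) * (β + 1)) := by
      rw [hSn]; push_cast; ring
    rw [eS] at h2 ⊢
    have hlt : y.1.2 μ < (Mh : ℤ) * (ℓ + 1) * (β + 1) := Int.lt_of_mul_lt_mul_left h2 (by positivity)
    have hn0 : (0 : ℤ) ≤ n := by positivity
    nlinarith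
  have h1r : (bigSide ℓ Mh y.1.1 : ℝ) * (β : ℝ) ≤ (n : ℝ) * (y.1.2 μ : ℝ) := by exact_mod_cast h1
  have h3r : (n : ℝ) * (y.1.2 μ : ℝ) + n ≤ (bigSide ℓ Mh y.1.1 : ℝ) * (β : ℝ) + (bigSide ℓ Mh y.1.1 : ℝ) := by
    exact_mod_cast h3
  have hn1r : (1 : ℝ) ≤ n := by exact_mod_cast hn1
  have ecen : cen D y μ = (n : ℝ) * (y.1.2 μ : ℝ) + ((n : ℝ) - 1) / 2 := rfl
  have ectr : ctr D (own D y) μ = ((β : ℝ) + 1 / 2) * (bigSide ℓ Mh y.1.1 : ℝ) := rfl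
  have eside : side D (own D y) = (bigSide ℓ Mh y.1.1 : ℝ) := rfl
  rw [ecen, ectr, eside]
  constructor <;> linarith

/-- `θ_{own y}(cen y) = 1`. [cite: Balaban1984PropagatorsII, p.229, bookkeeping] -/
theorem theta_own (hMh : 1 ≤ Mh) (y : ↥(bset D)) : theta D (own D y) (cen D y) = 1 :=
  theta_eq_one D hMh (dist_cen_ctr_own_le D hMh y)

/-! ## §3 The partition of unity (2.36) on `𝔅` and the enlarged cubes -/

/-- the normalising sum `Σ_□ θ_□(cen y)²`. [cite: Balaban1984PropagatorsII, (2.36) p.229, bookkeeping] -/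
def nsq (y : ↥(bset D)) : ℝ := ∑ i, theta D i (cen D y) ^ 2

/-- `Σ_□ θ_□(cen y)² ≥ 1` (the own big block contributes 1). [cite: Balaban1984PropagatorsII, (2.36) p.229, bookkeeping] -/
theorem one_le_nsq (hMh : 1 ≤ Mh) (y : ↥(bset D)) : 1 ≤ nsq D y := by
  unfold nsq
  calc (1 : ℝ) = theta D (own D y) (cen D y) ^ 2 := by rw [theta_own D hMh y]; norm_num
    _ ≤ ∑ i, theta D i (cen D y) ^ 2 :=
        Finset.single_le_sum (f := fun i => theta D i (cen D y) ^ 2) (fun i _ => sq_nonneg _) (Finset.mem_univ _)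

/-- **`h_□` ON `𝔅`**: `θ_□(cen y)/(Σ_{□′} θ_{□′}(cen y)²)^{1/2}`. [cite: Balaban1984PropagatorsII, (2.36) p.229] -/
def hcov (i : ↥(cubes D)) (y : ↥(bset D)) : ℝ := theta D i (cen D y) / Real.sqrt (nsq D y)

/-- `h_□ ≥ 0`. [cite: Balaban1984PropagatorsII, (2.36) p.229, bookkeeping] -/
theorem hcov_nonneg (i : ↥(cubes D)) (y : ↥(bset D)) : 0 ≤ hcov D i y :=
  div_nonneg (theta_nonneg D i _) (Real.sqrt_nonneg _)

/-- `h_□ ≤ 1` (from (2.36)). [cite: Balaban1984PropagatorsII, (2.36) p.229, bookkeeping] -/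
theorem hcov_le_one (hMh : 1 ≤ Mh) (i : ↥(cubes D)) (y : ↥(bset D)) : hcov D i y ≤ 1 := by
  have h1 : 1 ≤ Real.sqrt (nsq D y) := by
    rw [← Real.sqrt_one]; exact Real.sqrt_le_sqrt (one_le_nsq D hMh y)
  unfold hcov
  rw [div_le_one (by linarith)]
  exact (theta_le_one D i _).trans h1

/-- **(2.36) `Σ_□ h_□(y)² = 1`** on `𝔅`. [cite: Balaban1984PropagatorsII, (2.36) p.229] -/
theorem sum_hcov_sq (hMh : 1 ≤ Mh) (y : ↥(bset D)) : ∑ i, hcov D i y ^ 2 = 1 := by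
  have h1 := one_le_nsq D hMh y
  unfold hcov
  simp_rw [div_pow]
  rw [← Finset.sum_div, Real.sq_sqrt (by linarith)]
  show nsq D y / nsq D y = 1
  exact div_self (ne_of_gt (lt_of_lt_of_le one_pos h1))

/-- `h_□(y) ≠ 0 ⟹ θ_□(cen y) ≠ 0` (`supp h_□ ⊂ □`). [cite: Balaban1984PropagatorsII, p.229 before (2.36), bookkeeping] -/
theorem theta_ne_zero_of_hcov_ne_zero {i : ↥(cubes D)} {y : ↥(bset D)} (h : hcov D i y ≠ 0) :
    theta D i (cen D y) ≠ 0 := fun h0 => h (by unfold hcov; rw [h0, zero_div])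

/-- **THE ENLARGED CUBE `□⁺`**: the blocks whose centre is within `5S/4` of the centre (□ = within `S`; print's □̃ of
«the size 4M» would be within `2S`). [cite: Balaban1984PropagatorsII, p.235 («a second cube □̃ containing □ in the middle»)] -/
def Q (i : ↥(cubes D)) : Finset ↥(bset D) :=
  Finset.univ.filter fun y => dist (cen D y) (ctr D i) ≤ 5 / 4 * side D i

/-- membership in `□⁺`. [cite: Balaban1984PropagatorsII, p.235, dictionary] -/
theorem mem_Q {i : ↥(cubes D)} {y : ↥(bset D)} : y ∈ Q D i ↔ dist (cen D y) (ctr D i) ≤ 5 / 4 * side D i := by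
  unfold Q; rw [Finset.mem_filter]; exact ⟨fun h => h.2, fun h => ⟨Finset.mem_univ _, h⟩⟩

/-- the indicator of `□⁺` (the binder `pf` of the assembly). [cite: Balaban1984PropagatorsII, (2.82) p.237 («(□′ − 1)»)] -/
def cubeInd (i : ↥(cubes D)) (y : ↥(bset D)) : ℝ := if y ∈ Q D i then 1 else 0

/-- `cubeInd ∈ {0, 1}` (the binder `hpf01`: □′ acts as a characteristic function). [cite: Balaban1984PropagatorsII, (2.82) p.237 («(□′ − 1)»), bookkeeping] -/
theorem cubeInd_zero_or_one (i : ↥(cubes D)) (y : ↥(bset D)) : cubeInd D i y = 0 ∨ cubeInd D i y = 1 := by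
  unfold cubeInd; split_ifs <;> simp

/-- `cubeInd = 1` on `□⁺`. [cite: Balaban1984PropagatorsII, (2.82) p.237, bookkeeping] -/
theorem cubeInd_eq_one {i : ↥(cubes D)} {y : ↥(bset D)} (h : y ∈ Q D i) : cubeInd D i y = 1 := if_pos h

/-- `cubeInd = 0 ⟺ ∉ □⁺`. [cite: Balaban1984PropagatorsII, (2.82) p.237, bookkeeping] -/
theorem cubeInd_eq_zero_iff {i : ↥(cubes D)} {y : ↥(bset D)} : cubeInd D i y = 0 ↔ y ∉ Q D i := by
  unfold cubeInd; split_ifs with h <;> simp [h]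

/-- `θ_□(cen y) ≠ 0 ⟹ y ∈ □⁺`. [cite: Balaban1984PropagatorsII, p.235, bookkeeping] -/
theorem mem_Q_of_theta_ne_zero (hMh : 1 ≤ Mh) {i : ↥(cubes D)} {y : ↥(bset D)} (h : theta D i (cen D y) ≠ 0) :
    y ∈ Q D i :=
  (mem_Q D).2 (by have := dist_lt_of_theta_ne_zero D hMh h; have := side_pos D hMh i; linarith)

/-- `h_□(y) ≠ 0 ⟹ y ∈ □⁺` (`supp h_□ ⊂ □ ⊂ □⁺`). [cite: Balaban1984PropagatorsII, p.235, bookkeeping] -/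
theorem mem_Q_of_hcov_ne_zero (hMh : 1 ≤ Mh) {i : ↥(cubes D)} {y : ↥(bset D)} (h : hcov D i y ≠ 0) : y ∈ Q D i :=
  mem_Q_of_theta_ne_zero D hMh (theta_ne_zero_of_hcov_ne_zero D h)

/-- **`□⁺·h_□ = h_□`** (the binder `hph`). [cite: Balaban1984PropagatorsII, (2.82) p.237] -/
theorem cubeInd_mul_hcov (hMh : 1 ≤ Mh) (i : ↥(cubes D)) (y : ↥(bset D)) : cubeInd D i y * hcov D i y = hcov D i y := by
  by_cases h : hcov D i y = 0
  · rw [h, mul_zero]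
  · rw [cubeInd_eq_one D (mem_Q_of_hcov_ne_zero D hMh h), one_mul]

/-! ## §4 The two-level window of a cube -/

/-- the whole lattice cube of a block lies in the box (the block grid divides the box sides). [cite: Balaban1984PropagatorsII, (2.1) p.224, bookkeeping] -/
theorem corner_add_mem (y : ↥(bset D)) (t : Fin (d + 1) → ℤ) (ht0 : ∀ μ, 0 ≤ t μ)
    (ht : ∀ μ, t μ < (((ℓ + 1) ^ y.1.1 : ℕ) : ℤ)) : (fun μ => corner D y μ + t μ) ∈ boxDom (N0 ℓ Mh k P) := by
  have hc := mem_boxDom.1 (corner_mem D y)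
  obtain ⟨-, hjk⟩ := scale_bounds D y
  rw [mem_boxDom]
  intro μ
  refine ⟨by have := (hc μ).1; have := ht0 μ; omega, ?_⟩
  set n : ℕ := (ℓ + 1) ^ y.1.1 with hn
  have hn0 : (0 : ℤ) < n := by positivity
  have hpow : (ℓ + 1) ^ k = n * (ℓ + 1) ^ (k - y.1.1) := by
    rw [hn, ← pow_add, Nat.add_sub_cancel' hjk]
  obtain ⟨q, hq⟩ : ∃ q : ℕ, N0 ℓ Mh k P μ = n * q :=
    ⟨(ℓ + 1) ^ (k - y.1.1) * ((ℓ + 1) * (Mh * P μ)), by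
      show (ℓ + 1) ^ k * ((ℓ + 1) * (Mh * P μ)) = _
      rw [hpow, mul_assoc]⟩
  have hlt := (hc μ).2
  have hcμ : corner D y μ = (n : ℤ) * y.1.2 μ := rfl
  rw [hq] at hlt ⊢
  rw [hcμ] at hlt
  push_cast at hlt ⊢
  have hlam : y.1.2 μ < q := Int.lt_of_mul_lt_mul_left hlt hn0.le
  have h1 : (n : ℤ) * (y.1.2 μ + 1) ≤ (n : ℤ) * q := Int.mul_le_mul_of_nonneg_left (by omega) hn0.le
  have := ht μ
  show (n : ℤ) * y.1.2 μ + t μ < n * q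
  linarith

/-- the site of the block `y` nearest to a lattice point `t` (coordinatewise clamp into the cube of `y`).
[cite: Balaban1984PropagatorsII, (2.1) p.224, bookkeeping] -/
def projZ (y : ↥(bset D)) (t : Fin (d + 1) → ℤ) : Fin (d + 1) → ℤ :=
  fun μ => max (corner D y μ) (min (t μ) (corner D y μ + (((ℓ + 1) ^ y.1.1 : ℕ) : ℤ) - 1))

/-- the clamp lies in the cube of `y`. [folklore] -/
private theorem projZ_bounds (y : ↥(bset D)) (t : Fin (d + 1) → ℤ) (μ : Fin (d + 1)) :
    corner D y μ ≤ projZ D y t μ ∧ projZ D y t μ ≤ corner D y μ + (((ℓ + 1) ^ y.1.1 : ℕ) : ℤ) - 1 := by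
  have hn1 : (1 : ℤ) ≤ (((ℓ + 1) ^ y.1.1 : ℕ) : ℤ) := by exact_mod_cast Nat.one_le_pow _ _ (by omega)
  unfold projZ
  exact ⟨le_max_left _ _, max_le (by linarith) (min_le_right _ _)⟩

/-- the clamp is a box site. [folklore] -/
private theorem projZ_mem (y : ↥(bset D)) (t : Fin (d + 1) → ℤ) : projZ D y t ∈ boxDom (N0 ℓ Mh k P) := by
  have h := corner_add_mem D y (fun μ => projZ D y t μ - corner D y μ)
    (fun μ => by have := (projZ_bounds D y t μ).1; omega) (fun μ => by have := (projZ_bounds D y t μ).2; omega)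
  have e : (fun μ => corner D y μ + (projZ D y t μ - corner D y μ)) = projZ D y t := by funext μ; ring
  rwa [e] at h

/-- the clamp as a box site. [folklore] -/
def proj (y : ↥(bset D)) (t : Fin (d + 1) → ℤ) : ↥(boxDom (N0 ℓ Mh k P)) := ⟨projZ D y t, projZ_mem D y t⟩

/-- the clamp lies in the block `y`. [cite: Balaban1984PropagatorsII, (2.1) p.224, bookkeeping] -/
theorem blkOf_proj (y : ↥(bset D)) (t : Fin (d + 1) → ℤ) : blkOf D (proj D y t) = y := by
  rw [blkOf_eq_iff_blk]
  funext μ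
  show projZ D y t μ / (((ℓ + 1) ^ y.1.1 : ℕ) : ℤ) = y.1.2 μ
  obtain ⟨h1, h2⟩ := projZ_bounds D y t μ
  have hc : corner D y μ = (((ℓ + 1) ^ y.1.1 : ℕ) : ℤ) * y.1.2 μ := rfl
  have hn0 : (0 : ℤ) < (((ℓ + 1) ^ y.1.1 : ℕ) : ℤ) := by positivity
  have e : projZ D y t μ = (projZ D y t μ - corner D y μ) + (((ℓ + 1) ^ y.1.1 : ℕ) : ℤ) * y.1.2 μ := by
    rw [hc]; ring
  rw [e, Int.add_mul_ediv_left _ _ hn0.ne', Int.ediv_eq_zero_of_lt (by omega) (by omega), zero_add]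

/-- **THE CLAMP IS NO FARTHER FROM `t` THAN THE CENTRE OF THE BLOCK IS** (sup metric; the block is a full lattice cube). [cite: Balaban1984PropagatorsII, (2.1) p.224, bookkeeping] -/
theorem dist_proj_le (y : ↥(bset D)) (t : Fin (d + 1) → ℤ) :
    dist (toR (proj D y t).1) (toR t) ≤ dist (cen D y) (toR t) := by
  refine (dist_pi_le_iff dist_nonneg).2 fun μ => ?_
  rw [Real.dist_eq]
  have hμ := dist_le_pi_dist (cen D y) (toR t) μ
  rw [Real.dist_eq] at hμ
  refine le_trans ?_ hμ
  have hn1 : (1 : ℝ) ≤ (((ℓ + 1) ^ y.1.1 : ℕ) : ℝ) := by exact_mod_cast Nat.one_le_pow _ _ (by omega)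
  have hc : ((corner D y μ : ℤ) : ℝ) = (((ℓ + 1) ^ y.1.1 : ℕ) : ℝ) * (y.1.2 μ : ℝ) := by
    show (((((ℓ + 1) ^ y.1.1 : ℕ) : ℤ) * y.1.2 μ : ℤ) : ℝ) = _
    rw [Int.cast_mul, Int.cast_natCast]
  have hcen : cen D y μ = (((ℓ + 1) ^ y.1.1 : ℕ) : ℝ) * (y.1.2 μ : ℝ) + ((((ℓ + 1) ^ y.1.1 : ℕ) : ℝ) - 1) / 2 := rfl
  have e : toR (proj D y t).1 μ = max ((corner D y μ : ℤ) : ℝ)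
      (min ((t μ : ℤ) : ℝ) (((corner D y μ : ℤ) : ℝ) + (((ℓ + 1) ^ y.1.1 : ℕ) : ℝ) - 1)) := by
    show ((projZ D y t μ : ℤ) : ℝ) = _
    unfold projZ
    rw [Int.cast_max, Int.cast_min, Int.cast_sub, Int.cast_add, Int.cast_one, Int.cast_natCast]
  rw [e]
  show |_ - ((t μ : ℤ) : ℝ)| ≤ |cen D y μ - ((t μ : ℤ) : ℝ)|
  exact abs_clamp_sub_le (by rw [hc, hcen]; linarith) (by rw [hc, hcen]; linarith)

/-- the clamp of the witness into a block of `□⁺` is within `< 2S` of the witness. [cite: Balaban1984PropagatorsII, (2.2) p.224 with p.235, bookkeeping] -/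
theorem supNorm_proj_wit_lt (hMh : 1 ≤ Mh) {i : ↥(cubes D)} {y : ↥(bset D)} (hy : y ∈ Q D i) :
    supNorm ((proj D y (wit D i).1).1 - (wit D i).1) < 2 * (bigSide ℓ Mh i.1.1 : ℝ) := by
  have hS := side_pos D hMh i
  rw [supNorm_eq_dist]
  calc dist (toR (proj D y (wit D i).1).1) (toR (wit D i).1) ≤ dist (cen D y) (toR (wit D i).1) := dist_proj_le D y _
    _ ≤ dist (cen D y) (ctr D i) + dist (toR (wit D i).1) (ctr D i) := dist_triangle_right _ _ _
    _ ≤ 5 / 4 * side D i + side D i / 2 := add_le_add ((mem_Q D).1 hy) (dist_toR_ctr_le D hMh (blk_wit D i))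
    _ < 2 * (bigSide ℓ Mh i.1.1 : ℝ) := by show _ < 2 * side D i; linarith

/-- **THE WINDOW OF `□⁺`**: every block of the enlarged cube of a level-`j` active big block has level `j − 1`, `j` or
`j + 1` ((2.2) with `R ≥ 2L`, `Domains.lev_window`). [cite: Balaban1984PropagatorsII, (2.2) p.224 with p.235 («either □̃ ⊂ B^j(Λ_j), or it intersects B^{j+1}(Λ_{j+1}) also»)] -/
theorem window (hMh : 1 ≤ Mh) (hR : 2 * (ℓ + 1) ≤ R) {i : ↥(cubes D)} {y : ↥(bset D)} (hy : y ∈ Q D i) :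
    i.1.1 ≤ y.1.1 + 1 ∧ y.1.1 ≤ i.1.1 + 1 := by
  have hzl : D.lev (proj D y (wit D i).1).1 = y.1.1 := lev_eq_of_blkOf_eq D (blkOf_proj D y _)
  have hw := D.lev_window hR (wit D i).2 (proj D y (wit D i).1).2 (lev_wit D i) (supNorm_proj_wit_lt D hMh hy)
  rw [hzl] at hw
  exact hw

/-- the enlarged cube meets the level below («□̃ ⊂ B^j(Λ_j)» fails downwards). [cite: Balaban1984PropagatorsII, p.235] -/
def Down (i : ↥(cubes D)) : Prop := ∃ y ∈ Q D i, y.1.1 + 1 = i.1.1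

open Classical in
/-- **THE SCALE `j(□)` OF THE CUBE** («□ connected with a L^jη-scale»): the finer of the (at most two) levels met by `□⁺`.
[cite: Balaban1984PropagatorsII, p.235, p.237 (2.83)] -/
def js (i : ↥(cubes D)) : ℕ := if Down D i then i.1.1 - 1 else i.1.1

/-- `js □ ≤ j ≤ js □ + 1`. [cite: Balaban1984PropagatorsII, p.235, bookkeeping] -/
theorem js_le (i : ↥(cubes D)) : js D i ≤ i.1.1 ∧ i.1.1 ≤ js D i + 1 := by
  unfold js; split_ifs <;> omega

/-- **THE TWO-LEVEL WINDOW** (the binder `hcube`): every block of `□⁺` has level `js □` or `js □ + 1` — never both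
`j − 1` and `j + 1` (`Domains.not_both_sides`). [cite: Balaban1984PropagatorsII, p.235 («either □̃ ⊂ B^j(Λ_j), or it intersects B^{j+1}(Λ_{j+1}) also»)] -/
theorem hcube (hℓ : 1 ≤ ℓ) (hMh : 1 ≤ Mh) (hR : 2 * (ℓ + 1) ≤ R) {i : ↥(cubes D)} {y : ↥(bset D)} (hy : y ∈ Q D i) :
    js D i ≤ y.1.1 ∧ y.1.1 ≤ js D i + 1 := by
  have hw := window D hMh hR hy
  have key : ∀ y' ∈ Q D i, y'.1.1 + 1 = i.1.1 → y.1.1 ≤ i.1.1 := by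
    intro y' hy' hl
    by_contra hgt
    have hy1 : y.1.1 = i.1.1 + 1 := by omega
    exact D.not_both_sides hℓ hR (proj D y' (wit D i).1).2 (proj D y (wit D i).1).2
      (supNorm_proj_wit_lt D hMh hy') (supNorm_proj_wit_lt D hMh hy)
      (by rw [lev_eq_of_blkOf_eq D (blkOf_proj D y' _)]; exact hl)
      (by rw [lev_eq_of_blkOf_eq D (blkOf_proj D y _)]; exact hy1)
  unfold js
  by_cases hdn : Down D i
  · rw [if_pos hdn]
    obtain ⟨y', hy', hl⟩ := hdn
    have := key y' hy' hl
    omega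
  · rw [if_neg hdn]
    have : y.1.1 + 1 ≠ i.1.1 := fun h => hdn ⟨y, hy, h⟩
    omega

/-! ## §5 Finite overlap -/

/-- the label of a cube active near a block centre is one of two per coordinate. [cite: Balaban1984PropagatorsII, p.229 («each cube being a sum of 2^d big blocks»), bookkeeping] -/
theorem near_coord (hMh : 1 ≤ Mh) {i : ↥(cubes D)} {y : ↥(bset D)} (h : dist (cen D y) (ctr D i) < side D i)
    (μ : Fin (d + 1)) : i.1.2 μ - ⌊cen D y μ / side D i - 1 / 2⌋ ∈ ({0, 1} : Finset ℤ) := by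
  have hS := side_pos D hMh i
  have hμ := lt_of_le_of_lt (dist_le_pi_dist (cen D y) (ctr D i) μ) h
  rw [Real.dist_eq] at hμ
  set u : ℝ := cen D y μ / side D i - 1 / 2 with hu
  have hβ : |u - (i.1.2 μ : ℝ)| < 1 := by
    have e : u - (i.1.2 μ : ℝ) = (cen D y μ - ctr D i μ) / side D i := by
      rw [hu]; unfold ctr; field_simp; ring
    rw [e, abs_div, abs_of_pos hS, div_lt_one hS]; exact hμ
  have h1 := Int.floor_le u
  have h2 := Int.lt_floor_add_one u
  rw [abs_lt] at hβ
  have hge : ⌊u⌋ ≤ i.1.2 μ := by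
    by_contra hlt
    have : (i.1.2 μ : ℝ) + 1 ≤ (⌊u⌋ : ℝ) := by exact_mod_cast (show i.1.2 μ + 1 ≤ ⌊u⌋ by omega)
    linarith
  have hle : i.1.2 μ ≤ ⌊u⌋ + 1 := by
    by_contra hlt
    have : (⌊u⌋ : ℝ) + 2 ≤ (i.1.2 μ : ℝ) := by exact_mod_cast (show ⌊u⌋ + 2 ≤ i.1.2 μ by omega)
    linarith
  rw [Finset.mem_insert, Finset.mem_singleton]; omega

/-- **FINITE OVERLAP OF THE BUMPS**: at most `3·2^{d+1}` bumps are non-zero at a block centre (levels `j(y) − 1 … j(y) + 1`,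
two labels per coordinate). [cite: Balaban1984PropagatorsII, p.229 («each cube being a sum of 2^d big blocks»)] -/
theorem card_filter_theta_ne_zero_le (hMh : 1 ≤ Mh) (hR : 2 * (ℓ + 1) ≤ R) (y : ↥(bset D)) :
    #(Finset.univ.filter fun i : ↥(cubes D) => theta D i (cen D y) ≠ 0) ≤ 3 * 2 ^ (d + 1) := by
  classical
  set m : ℕ → Fin (d + 1) → ℤ := fun j μ => ⌊cen D y μ / (bigSide ℓ Mh j : ℝ) - 1 / 2⌋ with hm
  set T : Finset (ℕ × (Fin (d + 1) → ℤ)) := (Finset.Icc (y.1.1 - 1) (y.1.1 + 1)).biUnion fun j =>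
    (Fintype.piFinset fun _ : Fin (d + 1) => ({0, 1} : Finset ℤ)).image fun e => (j, fun μ => m j μ + e μ) with hT
  have hT3 : #T ≤ 3 * 2 ^ (d + 1) := by
    refine Finset.card_biUnion_le.trans ?_
    calc ∑ j ∈ Finset.Icc (y.1.1 - 1) (y.1.1 + 1),
          #((Fintype.piFinset fun _ : Fin (d + 1) => ({0, 1} : Finset ℤ)).image fun e => (j, fun μ => m j μ + e μ))
        ≤ ∑ _j ∈ Finset.Icc (y.1.1 - 1) (y.1.1 + 1), 2 ^ (d + 1) := Finset.sum_le_sum fun j _ => by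
          refine Finset.card_image_le.trans (le_of_eq ?_)
          rw [Fintype.card_piFinset_const, Finset.card_pair (by norm_num)]
      _ = #(Finset.Icc (y.1.1 - 1) (y.1.1 + 1)) * 2 ^ (d + 1) := by rw [Finset.sum_const, smul_eq_mul]
      _ ≤ 3 * 2 ^ (d + 1) := by rw [Nat.card_Icc]; exact Nat.mul_le_mul_right _ (by omega)
  have hsub : (Finset.univ.filter fun i : ↥(cubes D) => theta D i (cen D y) ≠ 0).map
      ⟨Subtype.val, Subtype.val_injective⟩ ⊆ T := by
    intro c hc
    rw [Finset.mem_map] at hc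
    obtain ⟨i, hi, rfl⟩ := hc
    have hne := (Finset.mem_filter.1 hi).2
    have hdist := dist_lt_of_theta_ne_zero D hMh hne
    have hw := window D hMh hR (mem_Q_of_theta_ne_zero D hMh hne)
    rw [hT, Finset.mem_biUnion]
    refine ⟨i.1.1, by rw [Finset.mem_Icc]; omega, ?_⟩
    rw [Finset.mem_image]
    refine ⟨fun μ => i.1.2 μ - m i.1.1 μ, ?_, ?_⟩
    · rw [Fintype.mem_piFinset]; intro μ; exact near_coord D hMh hdist μ
    · show (i.1.1, fun μ => m i.1.1 μ + (i.1.2 μ - m i.1.1 μ)) = i.1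
      refine Prod.ext rfl (funext fun μ => ?_)
      show m i.1.1 μ + (i.1.2 μ - m i.1.1 μ) = i.1.2 μ
      ring
  calc #(Finset.univ.filter fun i : ↥(cubes D) => theta D i (cen D y) ≠ 0)
      = #((Finset.univ.filter fun i : ↥(cubes D) => theta D i (cen D y) ≠ 0).map
          ⟨Subtype.val, Subtype.val_injective⟩) := (Finset.card_map _).symm
    _ ≤ #T := Finset.card_le_card hsub
    _ ≤ 3 * 2 ^ (d + 1) := hT3

/-- **FINITE OVERLAP OF THE COVER** (the binder `hover`, `n₀ = 3·2^{d+1}`). [cite: Balaban1984PropagatorsII, p.229 («each cube being a sum of 2^d big blocks»)] -/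
theorem card_filter_hcov_ne_zero_le (hMh : 1 ≤ Mh) (hR : 2 * (ℓ + 1) ≤ R) (y : ↥(bset D)) :
    #(Finset.univ.filter fun i : ↥(cubes D) => hcov D i y ≠ 0) ≤ 3 * 2 ^ (d + 1) := by
  refine (Finset.card_le_card fun i hi => ?_).trans (card_filter_theta_ne_zero_le D hMh hR y)
  rw [Finset.mem_filter] at hi ⊢
  exact ⟨hi.1, theta_ne_zero_of_hcov_ne_zero D hi.2⟩

/-! ## §6 The walk lemma and the gap -/

/-- powers of `L` are monotone. [folklore] -/
private theorem powL_mono {a b : ℕ} (h : a ≤ b) : (((ℓ + 1) ^ a : ℕ) : ℝ) ≤ (((ℓ + 1) ^ b : ℕ) : ℝ) := by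
  exact_mod_cast Nat.pow_le_pow_right (by omega) h

variable {D}

/-- **THE WALK LEMMA**: a chain of admissible bonds from a block of level `≤ m` either has sup-displacement `≤ |Γ|·L^m`
(all its blocks have level `≤ m`, bond lengths `≤ L^m`) or reaches a SITE of level `≥ m + 1` within `|Γ|·L^m` of the
centre of its start (the induction of `B6Geom246MultiLevelBox.walk_disp`). [cite: Balaban1984PropagatorsII, (2.46) p.231, (2.57) p.233] -/
theorem walk_disp_or_exit {m : ℕ} :
    ∀ {a b : ↥(bset D)} (p : (bond D).Walk a b), a.1.1 ≤ m →
      dist (cen D a) (cen D b) ≤ (p.length : ℝ) * (((ℓ + 1) ^ m : ℕ) : ℝ) ∨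
      ∃ t : ↥(boxDom (N0 ℓ Mh k P)), m + 1 ≤ D.lev t.1 ∧
        dist (cen D a) (toR t.1) ≤ (p.length : ℝ) * (((ℓ + 1) ^ m : ℕ) : ℝ) := by
  intro a b p
  induction p with
  | nil => intro _; left; rw [SimpleGraph.Walk.length_nil, dist_self]; simp
  | @cons a c b h p ih =>
    intro ha
    have hLm : (1 : ℝ) ≤ (((ℓ + 1) ^ m : ℕ) : ℝ) := by exact_mod_cast Nat.one_le_pow _ _ (by omega)
    have hlen : (((SimpleGraph.Walk.cons h p).length : ℕ) : ℝ) = (p.length : ℝ) + 1 := by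
      rw [SimpleGraph.Walk.length_cons]; push_cast; ring
    have hpl : (0 : ℝ) ≤ (p.length : ℝ) := by positivity
    by_cases hc : m < c.1.1
    · -- the first bond already exits: a site of `c` is within `(L^a − 1)/2 + 1 ≤ L^m` of the centre of `a`
      right
      obtain ⟨-, x₁, x₂, hx₁, hx₂, hd⟩ := bond_adj.1 h
      refine ⟨x₂, by rw [lev_eq_of_blkOf_eq D hx₂]; omega, ?_⟩
      rw [supNorm_eq_dist] at hd
      have h1 := dist_toR_cen_le D hx₁
      rw [dist_comm] at h1
      have ha1 := powL_mono (ℓ := ℓ) ha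
      calc dist (cen D a) (toR x₂.1) ≤ dist (cen D a) (toR x₁.1) + dist (toR x₁.1) (toR x₂.1) := dist_triangle _ _ _
        _ ≤ ((((ℓ + 1) ^ a.1.1 : ℕ) : ℝ) - 1) / 2 + 1 := by linarith
        _ ≤ (((ℓ + 1) ^ m : ℕ) : ℝ) := by linarith
        _ ≤ (((SimpleGraph.Walk.cons h p).length : ℕ) : ℝ) * (((ℓ + 1) ^ m : ℕ) : ℝ) := by
            rw [hlen]; nlinarith
    · push Not at hc
      have hab : dist (cen D a) (cen D c) ≤ (((ℓ + 1) ^ m : ℕ) : ℝ) :=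
        (dist_cen_le_of_adj h).trans (powL_mono (max_le ha hc))
      rcases ih hc with hdisp | ⟨t, ht, hdist⟩
      · left
        calc dist (cen D a) (cen D b) ≤ dist (cen D a) (cen D c) + dist (cen D c) (cen D b) := dist_triangle _ _ _
          _ ≤ (((ℓ + 1) ^ m : ℕ) : ℝ) + (p.length : ℝ) * (((ℓ + 1) ^ m : ℕ) : ℝ) := add_le_add hab hdisp
          _ = (((SimpleGraph.Walk.cons h p).length : ℕ) : ℝ) * (((ℓ + 1) ^ m : ℕ) : ℝ) := by rw [hlen]; ring
      · right
        refine ⟨t, ht, ?_⟩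
        calc dist (cen D a) (toR t.1) ≤ dist (cen D a) (cen D c) + dist (cen D c) (toR t.1) := dist_triangle _ _ _
          _ ≤ (((ℓ + 1) ^ m : ℕ) : ℝ) + (p.length : ℝ) * (((ℓ + 1) ^ m : ℕ) : ℝ) := add_le_add hab hdist
          _ = (((SimpleGraph.Walk.cons h p).length : ℕ) : ℝ) * (((ℓ + 1) ^ m : ℕ) : ℝ) := by rw [hlen]; ring

variable (D)

/-- **«y ∉ □̃′» IS FAR FROM `B^{j+2}`**: a site of level `≥ j + 2` is farther than `R·L·S − S/2` from the centre of an active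
big `j`-block ((2.2) at level `j + 1` between the witness and the site). [cite: Balaban1984PropagatorsII, (2.2) p.224] -/
theorem far_exit (hMh : 1 ≤ Mh) {i : ↥(cubes D)} {t : ↥(boxDom (N0 ℓ Mh k P))} (ht : i.1.1 + 2 ≤ D.lev t.1) :
    (R : ℝ) * (((ℓ : ℝ) + 1) * side D i) - side D i / 2 < dist (ctr D i) (toR t.1) := by
  have hsep := D.sep (i.1.1 + 1) (wit D i).1 (wit D i).2 t.1 t.2 (by rw [lev_wit]; omega) (by omega)
  rw [supNorm_eq_dist] at hsep
  have e : ((R * bigSide ℓ Mh (i.1.1 + 1) : ℕ) : ℝ) = (R : ℝ) * (((ℓ : ℝ) + 1) * side D i) := by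
    unfold side; rw [bigSide_succ]; push_cast; ring
  rw [e] at hsep
  have hw := dist_toR_ctr_le D hMh (blk_wit D i)
  have htri := dist_triangle (toR (wit D i).1) (ctr D i) (toR t.1)
  linarith

/-- **DISPLACEMENT VERSUS THE DISTANCE (2.46) FROM A BLOCK OF `□⁺`**: `|cen y″ − cen y|_∞ ≤ d(y″, y)·L^{j+1}`, unless the
shortest chain exits to `B^{j+2}`, which costs `d(y″, y)·L^{j+1} > (RL − 7/4)S`. [cite: Balaban1984PropagatorsII, (2.46) p.231 with (2.2) p.224] -/
theorem disp_or_far (hMh : 1 ≤ Mh) (hP : ∀ μ, 1 ≤ P μ) (hR : 2 * (ℓ + 1) ≤ R) {i : ↥(cubes D)} {y'' y : ↥(bset D)}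
    (hy'' : y'' ∈ Q D i) :
    dist (cen D y'') (cen D y) ≤ ((bond D).dist y'' y : ℝ) * (((ℓ + 1) ^ (i.1.1 + 1) : ℕ) : ℝ) ∨
    ((R : ℝ) * ((ℓ : ℝ) + 1) - 7 / 4) * side D i < ((bond D).dist y'' y : ℝ) * (((ℓ + 1) ^ (i.1.1 + 1) : ℕ) : ℝ) := by
  obtain ⟨p, hp⟩ := ((connected (D := D) hMh hP).preconnected y'' y).exists_walk_length_eq_dist
  have hwin := window D hMh hR hy''
  rcases walk_disp_or_exit (m := i.1.1 + 1) p (by omega) with h | ⟨t, ht, hdist⟩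
  · left; rwa [hp] at h
  · right
    rw [hp] at hdist
    have hfar := far_exit D hMh (t := t) (by omega)
    have hQ := (mem_Q D).1 hy''
    have htri : dist (ctr D i) (toR t.1) ≤ dist (cen D y'') (ctr D i) + dist (cen D y'') (toR t.1) := by
      rw [dist_comm (cen D y'') (ctr D i)]; exact dist_triangle _ _ _
    have e : ((R : ℝ) * ((ℓ : ℝ) + 1) - 7 / 4) * side D i
        = (R : ℝ) * (((ℓ : ℝ) + 1) * side D i) - side D i / 2 - 5 / 4 * side D i := by ring
    rw [e]; linarith

/-- the core of the gap: a block of `□⁺` and a block at sup-displacement `> S/4` are more than `M_h/4` bonds apart.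
[cite: Balaban1984PropagatorsII, (2.83) p.237 («y ∉ □̃′»), bookkeeping] -/
theorem gap_core (hMh : 1 ≤ Mh) (hP : ∀ μ, 1 ≤ P μ) (hR : 2 * (ℓ + 1) ≤ R) {i : ↥(cubes D)} {y'' y : ↥(bset D)}
    (hy'' : y'' ∈ Q D i) (hfar : side D i / 4 < dist (cen D y'') (cen D y)) :
    (Mh : ℝ) / 4 < ((bond D).dist y'' y : ℝ) := by
  have hS := side_pos D hMh i
  have eS : side D i = (((ℓ + 1) ^ (i.1.1 + 1) : ℕ) : ℝ) * Mh := side_eq D i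
  have hLp : (0 : ℝ) < (((ℓ + 1) ^ (i.1.1 + 1) : ℕ) : ℝ) := by positivity
  have hL1 : (1 : ℝ) ≤ (ℓ : ℝ) + 1 := by linarith [(Nat.cast_nonneg ℓ : (0 : ℝ) ≤ ℓ)]
  have hR1 : (2 : ℝ) * ((ℓ : ℝ) + 1) ≤ R := by exact_mod_cast hR
  have hRL : (2 : ℝ) ≤ (R : ℝ) * ((ℓ : ℝ) + 1) := by nlinarith
  have key : side D i / 4 < ((bond D).dist y'' y : ℝ) * (((ℓ + 1) ^ (i.1.1 + 1) : ℕ) : ℝ) := by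
    rcases disp_or_far D hMh hP hR hy'' (y := y) with h | h
    · linarith
    · nlinarith
  rw [eS] at key
  by_contra hle
  push Not at hle
  have := mul_le_mul_of_nonneg_right hle hLp.le
  linarith

/-- **THE GAP** (the binder `hgap`, `m_g = 1/(4L)`): if `y ∉ □⁺` and `h_□(y″) ≠ 0` then `d(y, y″) ≥ M_h/4 = (1/(4L))·M`
(«y ∉ □̃′»: the shortest chain either covers the sup-gap `S/4` at `≤ L^{j+1}` per bond or exits to `B^{j+2}`).
[cite: Balaban1984PropagatorsII, (2.83) p.237 («where we have used the fact that y ∉ □̃′»)] -/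
theorem gap_of_cubeInd_eq_zero (hMh : 1 ≤ Mh) (hP : ∀ μ, 1 ≤ P μ) (hR : 2 * (ℓ + 1) ≤ R) {i : ↥(cubes D)}
    {y y'' : ↥(bset D)} (hy : cubeInd D i y = 0) (hy'' : hcov D i y'' ≠ 0) :
    1 / (4 * ((ℓ : ℝ) + 1)) * (((ℓ : ℝ) + 1) * Mh) ≤ (geom D).dist y y'' := by
  have hS := side_pos D hMh i
  have hyQ : y ∉ Q D i := (cubeInd_eq_zero_iff D).1 hy
  rw [mem_Q] at hyQ
  push Not at hyQ
  have hθ := dist_lt_of_theta_ne_zero D hMh (theta_ne_zero_of_hcov_ne_zero D hy'')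
  have hfar : side D i / 4 < dist (cen D y'') (cen D y) := by
    have := dist_triangle (cen D y) (cen D y'') (ctr D i)
    rw [dist_comm (cen D y) (cen D y'')] at this
    linarith
  have hcore := gap_core D hMh hP hR (mem_Q_of_hcov_ne_zero D hMh hy'') hfar
  have e : (geom D).dist y y'' = ((bond D).dist y'' y : ℝ) := by
    show (((bond D).dist y y'' : ℕ) : ℝ) = _; rw [SimpleGraph.dist_comm]
  rw [e]
  have hL : (0 : ℝ) < (ℓ : ℝ) + 1 := by positivity
  have e2 : 1 / (4 * ((ℓ : ℝ) + 1)) * (((ℓ : ℝ) + 1) * Mh) = (Mh : ℝ) / 4 := by field_simp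
  rw [e2]; exact hcore.le

/-! ## §7 The Lipschitz bound of `h_□` in the distance (2.46) -/

/-- the Lipschitz constant `s = 8L + 2(d+1)L³(1 + 6·2^{d+1})` of `h_□` in units of `1/M`, `M = L·M_h`.
[cite: Balaban1984PropagatorsII, (2.84)–(2.85) p.237 («O(1)»), bookkeeping] -/
def sLip (d ℓ : ℕ) : ℝ := 8 * ((ℓ : ℝ) + 1) + 2 * ((d : ℝ) + 1) * ((ℓ : ℝ) + 1) ^ 3 * (1 + 6 * 2 ^ (d + 1))

/-- `s ≥ 0`. [cite: Balaban1984PropagatorsII, (2.84)–(2.85) p.237, bookkeeping] -/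
theorem sLip_nonneg {d ℓ : ℕ} : 0 ≤ sLip d ℓ := by unfold sLip; positivity

/-- sides two levels down are at most `L²` times smaller. [cite: Balaban1984PropagatorsII, (2.1) p.224, bookkeeping] -/
theorem side_le_Lsq_mul_side {i i' : ↥(cubes D)} (h : i.1.1 ≤ i'.1.1 + 2) :
    side D i ≤ ((ℓ : ℝ) + 1) ^ 2 * side D i' := by
  rw [side_eq, side_eq]
  have hMh0 : (0 : ℝ) ≤ Mh := by positivity
  have h1 : (ℓ + 1) ^ (i.1.1 + 1) ≤ (ℓ + 1) ^ 2 * (ℓ + 1) ^ (i'.1.1 + 1) := by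
    rw [← pow_add]; exact Nat.pow_le_pow_right (by omega) (by omega)
  have h2 : (((ℓ + 1) ^ (i.1.1 + 1) : ℕ) : ℝ) ≤ ((ℓ : ℝ) + 1) ^ 2 * (((ℓ + 1) ^ (i'.1.1 + 1) : ℕ) : ℝ) := by
    exact_mod_cast h1
  nlinarith

/-- the one-sided Lipschitz bound (at a block where `h_□ ≠ 0`). [cite: Balaban1984PropagatorsII, (2.84) p.237, bookkeeping] -/
theorem abs_hcov_sub_le_aux (hMh : 1 ≤ Mh) (hP : ∀ μ, 1 ≤ P μ) (hR : 2 * (ℓ + 1) ≤ R) {i : ↥(cubes D)}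
    {y y'' : ↥(bset D)} (hne : hcov D i y'' ≠ 0) :
    |hcov D i y - hcov D i y''| ≤ sLip d ℓ / (((ℓ : ℝ) + 1) * Mh) * ((bond D).dist y'' y : ℝ) := by
  have hS := side_pos D hMh i
  have hL1 : (1 : ℝ) ≤ (ℓ : ℝ) + 1 := by linarith [(Nat.cast_nonneg ℓ : (0 : ℝ) ≤ ℓ)]
  have hMh1 : (1 : ℝ) ≤ Mh := by exact_mod_cast hMh
  have eS : side D i = (((ℓ + 1) ^ (i.1.1 + 1) : ℕ) : ℝ) * Mh := side_eq D i
  set Lp : ℝ := (((ℓ + 1) ^ (i.1.1 + 1) : ℕ) : ℝ) with hLp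
  have hLp0 : 0 < Lp := by positivity
  set n : ℝ := ((bond D).dist y'' y : ℝ) with hn
  have hn0 : 0 ≤ n := by positivity
  have hy''Q := mem_Q_of_hcov_ne_zero D hMh hne
  have hθ'' := dist_lt_of_theta_ne_zero D hMh (theta_ne_zero_of_hcov_ne_zero D hne)
  have h01 : |hcov D i y - hcov D i y''| ≤ 1 := by
    rw [abs_sub_le_iff]
    constructor <;>
      linarith [hcov_nonneg D i y, hcov_nonneg D i y'', hcov_le_one D hMh i y, hcov_le_one D hMh i y'']
  have hs8 : 8 * ((ℓ : ℝ) + 1) ≤ sLip d ℓ := by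
    unfold sLip
    have : (0 : ℝ) ≤ 2 * ((d : ℝ) + 1) * ((ℓ : ℝ) + 1) ^ 3 * (1 + 6 * 2 ^ (d + 1)) := by positivity
    linarith
  have hsK : 2 * ((d : ℝ) + 1) * ((ℓ : ℝ) + 1) ^ 3 * (1 + 6 * 2 ^ (d + 1)) ≤ sLip d ℓ := by
    unfold sLip
    have : (0 : ℝ) ≤ 8 * ((ℓ : ℝ) + 1) := by positivity
    linarith
  by_cases hfar : side D i / 8 ≤ n * Lp
  · -- far pairs: `|Δh| ≤ 1 ≤ 8n/M_h`
    have hMn : (Mh : ℝ) ≤ 8 * n := by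
      rw [eS] at hfar
      by_contra hlt
      push Not at hlt
      have : 8 * n * Lp < Mh * Lp := mul_lt_mul_of_pos_right hlt hLp0
      linarith
    calc |hcov D i y - hcov D i y''| ≤ 1 := h01
      _ ≤ 8 * n / Mh := by rw [le_div_iff₀ (by linarith), one_mul]; exact hMn
      _ = 8 * ((ℓ : ℝ) + 1) / (((ℓ : ℝ) + 1) * Mh) * n := by field_simp
      _ ≤ sLip d ℓ / (((ℓ : ℝ) + 1) * Mh) * n :=
          mul_le_mul_of_nonneg_right (div_le_div_of_nonneg_right hs8 (by positivity)) hn0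
  · push Not at hfar
    -- near pairs: the displacement is `≤ n·L^{j+1} < S/8`
    have hL0 : (0 : ℝ) < (ℓ : ℝ) + 1 := by linarith
    have hR1 : (2 : ℝ) * ((ℓ : ℝ) + 1) ≤ R := by exact_mod_cast hR
    have hRL : (2 : ℝ) ≤ (R : ℝ) * ((ℓ : ℝ) + 1) := by nlinarith
    have hdisp : dist (cen D y'') (cen D y) ≤ n * Lp := by
      rcases disp_or_far D hMh hP hR hy''Q (y := y) with h | h
      · exact h
      · exfalso; nlinarith
    have hyQ : y ∈ Q D i := (mem_Q D).2 (by
      have := dist_triangle (cen D y) (cen D y'') (ctr D i)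
      rw [dist_comm (cen D y) (cen D y'')] at this
      linarith)
    have hwy := window D hMh hR hyQ
    have hwy'' := window D hMh hR hy''Q
    -- the bumps active at one of the two centres
    set N : Finset ↥(cubes D) :=
      Finset.univ.filter fun i' => theta D i' (cen D y'') ≠ 0 ∨ theta D i' (cen D y) ≠ 0 with hN
    have hNcard : (#N : ℝ) ≤ 6 * 2 ^ (d + 1) := by
      have h1 := card_filter_theta_ne_zero_le D hMh hR y''
      have h2 := card_filter_theta_ne_zero_le D hMh hR y
      have hsub : N ⊆ (Finset.univ.filter fun i' : ↥(cubes D) => theta D i' (cen D y'') ≠ 0) ∪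
          (Finset.univ.filter fun i' : ↥(cubes D) => theta D i' (cen D y) ≠ 0) := by
        intro i' hi'
        rw [hN, Finset.mem_filter] at hi'
        rw [Finset.mem_union, Finset.mem_filter, Finset.mem_filter]
        rcases hi'.2 with h | h
        · exact Or.inl ⟨Finset.mem_univ _, h⟩
        · exact Or.inr ⟨Finset.mem_univ _, h⟩
      have h3 : #N ≤ 3 * 2 ^ (d + 1) + 3 * 2 ^ (d + 1) :=
        (Finset.card_le_card hsub).trans ((Finset.card_union_le _ _).trans (add_le_add h1 h2))
      have h4 : (#N : ℝ) ≤ ((3 * 2 ^ (d + 1) + 3 * 2 ^ (d + 1) : ℕ) : ℝ) := by exact_mod_cast h3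
      push_cast at h4
      linarith
    -- each such bump has level `≥ j − 2`, so its Lipschitz constant is `≤ 2(d+1)L²/S`
    have hterm : ∀ i' ∈ N, |theta D i' (cen D y'') - theta D i' (cen D y)| ≤
        2 * ((d : ℝ) + 1) * ((ℓ : ℝ) + 1) ^ 2 / side D i * (n * Lp) := by
      intro i' hi'
      rw [hN, Finset.mem_filter] at hi'
      have hlev : i.1.1 ≤ i'.1.1 + 2 := by
        rcases hi'.2 with h | h
        · have := window D hMh hR (mem_Q_of_theta_ne_zero D hMh h); omega
        · have := window D hMh hR (mem_Q_of_theta_ne_zero D hMh h); omega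
      have hS' := side_pos D hMh i'
      have hSS := side_le_Lsq_mul_side D hlev
      have hd0 : (0 : ℝ) ≤ 2 * ((d : ℝ) + 1) := by positivity
      calc |theta D i' (cen D y'') - theta D i' (cen D y)|
          ≤ 2 * ((d : ℝ) + 1) / side D i' * dist (cen D y'') (cen D y) := abs_theta_sub_le D hMh i' _ _
        _ ≤ 2 * ((d : ℝ) + 1) / side D i' * (n * Lp) := mul_le_mul_of_nonneg_left hdisp (by positivity)
        _ ≤ 2 * ((d : ℝ) + 1) * ((ℓ : ℝ) + 1) ^ 2 / side D i * (n * Lp) := by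
            apply mul_le_mul_of_nonneg_right _ (by positivity)
            rw [div_le_div_iff₀ hS' hS]
            nlinarith
    have hiN : i ∈ N := by
      rw [hN, Finset.mem_filter]
      exact ⟨Finset.mem_univ _, Or.inl (theta_ne_zero_of_hcov_ne_zero D hne)⟩
    have hsq : |Real.sqrt (nsq D y'') - Real.sqrt (nsq D y)| ≤
        ∑ i' ∈ N, |theta D i' (cen D y'') - theta D i' (cen D y)| := by
      unfold nsq
      refine abs_sqrt_sub_sqrt_le N (fun i' => theta_nonneg D i' _) (fun i' => theta_le_one D i' _)
        (fun i' => theta_nonneg D i' _) (fun i' => theta_le_one D i' _) (fun i' hi' => ?_)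
        (one_le_nsq D hMh y'') (one_le_nsq D hMh y)
      rw [hN, Finset.mem_filter, not_and] at hi'
      have h := hi' (Finset.mem_univ _)
      push Not at h
      rw [h.1, h.2]
    have h1 : 1 ≤ Real.sqrt (nsq D y'') := by
      rw [← Real.sqrt_one]; exact Real.sqrt_le_sqrt (one_le_nsq D hMh y'')
    have h2 : 1 ≤ Real.sqrt (nsq D y) := by
      rw [← Real.sqrt_one]; exact Real.sqrt_le_sqrt (one_le_nsq D hMh y)
    have hK0 : (0 : ℝ) ≤ 2 * ((d : ℝ) + 1) * ((ℓ : ℝ) + 1) ^ 2 / side D i * (n * Lp) := by positivity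
    have hmain : |hcov D i y'' - hcov D i y| ≤
        (1 + 6 * 2 ^ (d + 1)) * (2 * ((d : ℝ) + 1) * ((ℓ : ℝ) + 1) ^ 2 / side D i * (n * Lp)) := by
      unfold hcov
      calc |theta D i (cen D y'') / Real.sqrt (nsq D y'') - theta D i (cen D y) / Real.sqrt (nsq D y)|
          ≤ |theta D i (cen D y'') - theta D i (cen D y)| + |Real.sqrt (nsq D y'') - Real.sqrt (nsq D y)| :=
            abs_div_sub_div_le (theta_nonneg D i _) (theta_le_one D i _) h1 h2
        _ ≤ 2 * ((d : ℝ) + 1) * ((ℓ : ℝ) + 1) ^ 2 / side D i * (n * Lp) +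
              ∑ i' ∈ N, 2 * ((d : ℝ) + 1) * ((ℓ : ℝ) + 1) ^ 2 / side D i * (n * Lp) :=
            add_le_add (hterm i hiN) (hsq.trans (Finset.sum_le_sum hterm))
        _ = (1 + #N) * (2 * ((d : ℝ) + 1) * ((ℓ : ℝ) + 1) ^ 2 / side D i * (n * Lp)) := by
            rw [Finset.sum_const, nsmul_eq_mul]; ring
        _ ≤ (1 + 6 * 2 ^ (d + 1)) * (2 * ((d : ℝ) + 1) * ((ℓ : ℝ) + 1) ^ 2 / side D i * (n * Lp)) :=
            mul_le_mul_of_nonneg_right (by linarith) hK0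
    rw [abs_sub_comm]
    refine hmain.trans ?_
    rw [eS]
    have e : (1 + 6 * 2 ^ (d + 1)) * (2 * ((d : ℝ) + 1) * ((ℓ : ℝ) + 1) ^ 2 / (Lp * Mh) * (n * Lp))
        = 2 * ((d : ℝ) + 1) * ((ℓ : ℝ) + 1) ^ 3 * (1 + 6 * 2 ^ (d + 1)) / (((ℓ : ℝ) + 1) * Mh) * n := by
      field_simp
    rw [e]
    exact mul_le_mul_of_nonneg_right (div_le_div_of_nonneg_right hsK (by positivity)) hn0

/-- **THE LIPSCHITZ BOUND OF `h_□` IN THE DISTANCE (2.46)** (the binder `hLip`): `|h_□(y) − h_□(y″)| ≤ (s/M)·d(y, y″)`,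
`M = L·M_h`, `s = sLip d L` («|∇h_□| ≤ O(1)(ML^jη)^{−1}» combined with «all the properties of the distance d(·, ·)»).
[cite: Balaban1984PropagatorsII, (2.84)–(2.85) p.237] -/
theorem abs_hcov_sub_le (hMh : 1 ≤ Mh) (hP : ∀ μ, 1 ≤ P μ) (hR : 2 * (ℓ + 1) ≤ R) (i : ↥(cubes D))
    (y y'' : ↥(bset D)) :
    |hcov D i y - hcov D i y''| ≤ sLip d ℓ / (((ℓ : ℝ) + 1) * Mh) * (geom D).dist y y'' := by
  have e1 : (geom D).dist y y'' = ((bond D).dist y'' y : ℝ) := by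
    show (((bond D).dist y y'' : ℕ) : ℝ) = _; rw [SimpleGraph.dist_comm]
  have e2 : (geom D).dist y y'' = ((bond D).dist y y'' : ℝ) := rfl
  by_cases h'' : hcov D i y'' ≠ 0
  · rw [e1]; exact abs_hcov_sub_le_aux D hMh hP hR h''
  · by_cases h : hcov D i y ≠ 0
    · rw [abs_sub_comm, e2]; exact abs_hcov_sub_le_aux D hMh hP hR h
    · push Not at h h''
      rw [h, h'', sub_self, abs_zero, e2]
      exact mul_nonneg (div_nonneg sLip_nonneg (by positivity)) (by positivity)

/-! ## §8 The cover hypotheses of Proposition 2.3, packaged -/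

/-- **THE COVER (2.36) OF `𝔅` WITH ITS CONSTANTS**, uniformly in `k`, `M_h ≥ 1`, `P`, `D` (`R ≥ 2L`): finite overlap
`n₀ = 3·2^{d+1}`, `cubeInd ∈ {0,1}`, `cubeInd·h = h`, `Σ h² = 1`, the Lipschitz bound `s/M` in `d`, the two-level window
`js □ ≤ j(y) ≤ js □ + 1` on `□⁺`, and the gap `(1/(4L))·M ≤ d(y, y″)` for `y ∉ □⁺`, `y″ ∈ supp h_□` — the binders
`hover`, `hpf01`, `hph`, `h236`, `hLip`, `hcube`, `hgap` of `B6Prop23TwoLevel.prop23_assembled_twoLevel` for the box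
geometry with `M = L·M_h`. [cite: Balaban1984PropagatorsII, (2.36) p.229, (2.70) p.235, (2.82)–(2.85) p.237] -/
theorem cover236_multiLevelBlocks (hℓ : 1 ≤ ℓ) (hMh : 1 ≤ Mh) (hP : ∀ μ, 1 ≤ P μ) (hR : 2 * (ℓ + 1) ≤ R) :
    (∀ y : ↥(bset D), #(Finset.univ.filter fun i : ↥(cubes D) => hcov D i y ≠ 0) ≤ 3 * 2 ^ (d + 1)) ∧
    (∀ (i : ↥(cubes D)) (y : ↥(bset D)), cubeInd D i y = 0 ∨ cubeInd D i y = 1) ∧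
    (∀ (i : ↥(cubes D)) (y : ↥(bset D)), cubeInd D i y * hcov D i y = hcov D i y) ∧
    (∀ y : ↥(bset D), ∑ i, hcov D i y ^ 2 = 1) ∧
    (∀ (i : ↥(cubes D)) (y y'' : ↥(bset D)),
      |hcov D i y - hcov D i y''| ≤ sLip d ℓ / (((ℓ : ℝ) + 1) * Mh) * (geom D).dist y y'') ∧
    (∀ (i : ↥(cubes D)) (y : ↥(bset D)), cubeInd D i y ≠ 0 → js D i ≤ y.1.1 ∧ y.1.1 ≤ js D i + 1) ∧
    (∀ (i : ↥(cubes D)) (y y'' : ↥(bset D)), cubeInd D i y = 0 → hcov D i y'' ≠ 0 →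
      1 / (4 * ((ℓ : ℝ) + 1)) * (((ℓ : ℝ) + 1) * Mh) ≤ (geom D).dist y y'') :=
  ⟨card_filter_hcov_ne_zero_le D hMh hR, cubeInd_zero_or_one D, cubeInd_mul_hcov D hMh, sum_hcov_sq D hMh,
    abs_hcov_sub_le D hMh hP hR,
    fun _ _ h => hcube D hℓ hMh hR (by by_contra hq; exact h ((cubeInd_eq_zero_iff D).2 hq)),
    fun _ _ _ hy hy'' => gap_of_cubeInd_eq_zero D hMh hP hR hy hy''⟩

end Cubes

end

end Literature.MathematicalPhysics.QuantumFieldTheory.Balaban1983to89.B6Cover236MultiLevelBlocks
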